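import Mathlib
import Summits.Ventures.PercRepro2.Defs
import Summits.Ventures.PercRepro2.Harris
import Summits.Ventures.PercRepro2.Graph
import Summits.Ventures.PercRepro2.Events
import Summits.Ventures.PercRepro2.BHKEvents
import Summits.Ventures.PercRepro2.ZCPendantSecondOrder
import Summits.Ventures.PercRepro2.CDRequired
import Summits.Ventures.PercRepro2.CDNested

/-!
# Row 2′CD from a monotone mixture of finitely many pinned worlds (blind cell PercRepro2,
mine-a g34; MINE-A.md §89.7, proofs/MINEA-CD-NESTED.md §3)

`CDNested.cd_of_two_worlds` for a family of worlds `p i`, `i < k`, with weights `ν i ≥ 0`: if the four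
`a₃`-required masses of `p` are `∑_{i<k} ν i · P_{p i}(·)` and the propensities are ordered along the
index — `P_i(QU) P_j(Q) ≤ P_j(QU) P_i(Q)` and `P_j(Qf) P_i(Q) ≤ P_i(Qf) P_j(Q)` for `i ≤ j` — then the
`a₃`-required anti-correlation holds (`ac_of_worlds`), hence row 2′CD (`cd_of_worlds`).  Proof: the
double sum `∑_{i,j} ν_iν_j (A_iD_j − B_iC_j)` is half the sum over pairs of
`(A_iD_j + A_jD_i) − (B_iC_j + B_jC_i)`, each `≤ 0` by `CDNested.cross_le` (BHK 1.4 in each world and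
the ordered propensities).  This is the mixture step of the nested-routes theorem for any number of
routes.  No definition; one seat.
-/

namespace Summit.Ventures.PercRepro2

namespace CDNestedMixture

section Algebra

variable {R : Type*} [Field R] [LinearOrder R] [IsStrictOrderedRing R]

/-- The symmetric pair bracket is `≤ 0` for every pair, given BHK in each world, the mass bounds and
the ordered propensities along `≤`. -/
lemma bracket_nonpos {k : ℕ} (A B C D : ℕ → R)
    (hA : ∀ i, 0 ≤ A i) (hB : ∀ i, 0 ≤ B i) (hC : ∀ i, 0 ≤ C i) (hD : ∀ i, 0 ≤ D i)
    (hAD : ∀ i, A i ≤ D i) (hBD : ∀ i, B i ≤ D i) (hCD : ∀ i, C i ≤ D i)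
    (hbhk : ∀ i, A i * D i ≤ B i * C i)
    (hβ : ∀ i j, i < k → j < k → i ≤ j → B i * D j ≤ B j * D i)
    (hγ : ∀ i j, i < k → j < k → i ≤ j → C j * D i ≤ C i * D j)
    (i j : ℕ) (hi : i < k) (hj : j < k) :
    A i * D j + A j * D i ≤ B i * C j + B j * C i := by
  rcases le_total i j with hij | hji
  · exact CDNested.cross_le (hA i) (hA j) (hB i) (hB j) (hC i) (hC j) (hD i) (hD j) (hAD i) (hAD j)
      (hBD i) (hBD j) (hCD i) (hCD j) (hbhk i) (hbhk j) (hβ i j hi hj hij) (hγ i j hi hj hij)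
  · have h := CDNested.cross_le (hA j) (hA i) (hB j) (hB i) (hC j) (hC i) (hD j) (hD i) (hAD j)
      (hAD i) (hBD j) (hBD i) (hCD j) (hCD i) (hbhk j) (hbhk i) (hβ j i hj hi hji) (hγ j i hj hi hji)
    linarith [h]

/-- **The mixture inequality for `k` worlds.** -/
lemma mixture_le {k : ℕ} (ν A B C D : ℕ → R) (hν : ∀ i, 0 ≤ ν i)
    (hbr : ∀ i j, i < k → j < k → A i * D j + A j * D i ≤ B i * C j + B j * C i) :
    (∑ i ∈ Finset.range k, ν i * A i) * (∑ j ∈ Finset.range k, ν j * D j) ≤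
      (∑ i ∈ Finset.range k, ν i * B i) * (∑ j ∈ Finset.range k, ν j * C j) := by
  rw [Finset.sum_mul_sum, Finset.sum_mul_sum,
    ← Finset.sum_product' (Finset.range k) (Finset.range k) (fun i j => ν i * A i * (ν j * D j)),
    ← Finset.sum_product' (Finset.range k) (Finset.range k) (fun i j => ν i * B i * (ν j * C j))]
  -- both sides are double sums over `range k ×ˢ range k`; symmetrise
  have key : ∀ i j, i < k → j < k →
      ν i * A i * (ν j * D j) + ν j * A j * (ν i * D i) ≤
        ν i * B i * (ν j * C j) + ν j * B j * (ν i * C i) := by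
    intro i j hi hj
    have h := hbr i j hi hj
    have hn : 0 ≤ ν i * ν j := mul_nonneg (hν i) (hν j)
    nlinarith [mul_le_mul_of_nonneg_left h hn]
  have hsymm : ∀ f : ℕ → ℕ → R, ∑ x ∈ Finset.range k ×ˢ Finset.range k, f x.1 x.2 =
      ∑ x ∈ Finset.range k ×ˢ Finset.range k, f x.2 x.1 := by
    intro f
    rw [Finset.sum_product, Finset.sum_product]
    exact Finset.sum_comm
  have e1 : 2 * ∑ x ∈ Finset.range k ×ˢ Finset.range k, ν x.1 * A x.1 * (ν x.2 * D x.2) =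
      ∑ x ∈ Finset.range k ×ˢ Finset.range k,
        (ν x.1 * A x.1 * (ν x.2 * D x.2) + ν x.2 * A x.2 * (ν x.1 * D x.1)) := by
    rw [Finset.sum_add_distrib, two_mul]
    congr 1
    exact hsymm fun i j => ν i * A i * (ν j * D j)
  have e2 : 2 * ∑ x ∈ Finset.range k ×ˢ Finset.range k, ν x.1 * B x.1 * (ν x.2 * C x.2) =
      ∑ x ∈ Finset.range k ×ˢ Finset.range k,
        (ν x.1 * B x.1 * (ν x.2 * C x.2) + ν x.2 * B x.2 * (ν x.1 * C x.1)) := by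
    rw [Finset.sum_add_distrib, two_mul]
    congr 1
    exact hsymm fun i j => ν i * B i * (ν j * C j)
  have hle : ∑ x ∈ Finset.range k ×ˢ Finset.range k,
      (ν x.1 * A x.1 * (ν x.2 * D x.2) + ν x.2 * A x.2 * (ν x.1 * D x.1)) ≤
      ∑ x ∈ Finset.range k ×ˢ Finset.range k,
        (ν x.1 * B x.1 * (ν x.2 * C x.2) + ν x.2 * B x.2 * (ν x.1 * C x.1)) := by
    refine Finset.sum_le_sum fun x hx => ?_
    rw [Finset.mem_product, Finset.mem_range, Finset.mem_range] at hx
    exact key x.1 x.2 hx.1 hx.2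
  linarith [e1, e2, hle]

end Algebra

section Main

variable {V : Type*} {E : Type*} [Fintype E] [DecidableEq E] [Fintype V] [DecidableEq V]
  {R : Type*} [Field R] [LinearOrder R] [IsStrictOrderedRing R]

/-- **The `a₃`-required anti-correlation from a monotone mixture of `k` worlds.** -/
theorem ac_of_worlds (p : E → R) (k : ℕ) (w : ℕ → E → R) (hw : ∀ i, IsProbVec (w i))
    (ends : E → Sym2 V) (a₁ a₂ a₃ o : V) {𝓔 : Set (Set V)} (h𝓔 : IsUpperSet 𝓔) (ν : ℕ → R)
    (hν : ∀ i, 0 ≤ ν i)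
    (hA : prob p ((connEvent ends a₁ a₂)ᶜ ∩ clusterInEvent ends a₁ 𝓔 ∩ connEvent ends a₁ a₃ ∩
        connEvent ends a₂ o) = ∑ i ∈ Finset.range k, ν i *
        prob (w i) ((connEvent ends a₁ a₂)ᶜ ∩ clusterInEvent ends a₁ 𝓔 ∩ connEvent ends a₂ o))
    (hB : prob p ((connEvent ends a₁ a₂)ᶜ ∩ clusterInEvent ends a₁ 𝓔 ∩ connEvent ends a₁ a₃) =
      ∑ i ∈ Finset.range k, ν i * prob (w i) ((connEvent ends a₁ a₂)ᶜ ∩ clusterInEvent ends a₁ 𝓔))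
    (hC : prob p ((connEvent ends a₁ a₂)ᶜ ∩ connEvent ends a₁ a₃ ∩ connEvent ends a₂ o) =
      ∑ i ∈ Finset.range k, ν i * prob (w i) ((connEvent ends a₁ a₂)ᶜ ∩ connEvent ends a₂ o))
    (hD : prob p ((connEvent ends a₁ a₂)ᶜ ∩ connEvent ends a₁ a₃) =
      ∑ i ∈ Finset.range k, ν i * prob (w i) (connEvent ends a₁ a₂)ᶜ)
    (hβ : ∀ i j, i < k → j < k → i ≤ j →
      prob (w i) ((connEvent ends a₁ a₂)ᶜ ∩ clusterInEvent ends a₁ 𝓔) *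
          prob (w j) (connEvent ends a₁ a₂)ᶜ ≤
        prob (w j) ((connEvent ends a₁ a₂)ᶜ ∩ clusterInEvent ends a₁ 𝓔) *
          prob (w i) (connEvent ends a₁ a₂)ᶜ)
    (hγ : ∀ i j, i < k → j < k → i ≤ j →
      prob (w j) ((connEvent ends a₁ a₂)ᶜ ∩ connEvent ends a₂ o) *
          prob (w i) (connEvent ends a₁ a₂)ᶜ ≤
        prob (w i) ((connEvent ends a₁ a₂)ᶜ ∩ connEvent ends a₂ o) *
          prob (w j) (connEvent ends a₁ a₂)ᶜ) :
    prob p ((connEvent ends a₁ a₂)ᶜ ∩ clusterInEvent ends a₁ 𝓔 ∩ connEvent ends a₁ a₃ ∩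
          connEvent ends a₂ o) * prob p ((connEvent ends a₁ a₂)ᶜ ∩ connEvent ends a₁ a₃) ≤
      prob p ((connEvent ends a₁ a₂)ᶜ ∩ clusterInEvent ends a₁ 𝓔 ∩ connEvent ends a₁ a₃) *
        prob p ((connEvent ends a₁ a₂)ᶜ ∩ connEvent ends a₁ a₃ ∩ connEvent ends a₂ o) := by
  rw [hA, hB, hC, hD]
  set Q := (connEvent ends a₁ a₂)ᶜ
  set U := clusterInEvent ends a₁ 𝓔
  set f := connEvent ends a₂ o
  refine mixture_le ν (fun i => prob (w i) (Q ∩ U ∩ f)) (fun i => prob (w i) (Q ∩ U))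
    (fun i => prob (w i) (Q ∩ f)) (fun i => prob (w i) Q) hν ?_
  refine bracket_nonpos (k := k) _ _ _ _ (fun i => prob_nonneg (hw i) _) (fun i => prob_nonneg (hw i) _)
    (fun i => prob_nonneg (hw i) _) (fun i => prob_nonneg (hw i) _)
    (fun i => prob_mono (hw i) (Set.inter_subset_left.trans Set.inter_subset_left))
    (fun i => prob_mono (hw i) Set.inter_subset_left) (fun i => prob_mono (hw i) Set.inter_subset_left)
    (fun i => CDNested.bhk_world (w i) (hw i) ends a₁ a₂ o h𝓔) hβ hγ

/-- **Row 2′CD from a monotone mixture of `k` worlds.** -/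
theorem cd_of_worlds (p : E → R) (hp : IsProbVec p) (k : ℕ) (w : ℕ → E → R)
    (hw : ∀ i, IsProbVec (w i)) (ends : E → Sym2 V) (a₁ a₂ a₃ o : V) {𝓔 : Set (Set V)}
    (h𝓔 : IsUpperSet 𝓔) (ν : ℕ → R) (hν : ∀ i, 0 ≤ ν i)
    (hA : prob p ((connEvent ends a₁ a₂)ᶜ ∩ clusterInEvent ends a₁ 𝓔 ∩ connEvent ends a₁ a₃ ∩
        connEvent ends a₂ o) = ∑ i ∈ Finset.range k, ν i *
        prob (w i) ((connEvent ends a₁ a₂)ᶜ ∩ clusterInEvent ends a₁ 𝓔 ∩ connEvent ends a₂ o))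
    (hB : prob p ((connEvent ends a₁ a₂)ᶜ ∩ clusterInEvent ends a₁ 𝓔 ∩ connEvent ends a₁ a₃) =
      ∑ i ∈ Finset.range k, ν i * prob (w i) ((connEvent ends a₁ a₂)ᶜ ∩ clusterInEvent ends a₁ 𝓔))
    (hC : prob p ((connEvent ends a₁ a₂)ᶜ ∩ connEvent ends a₁ a₃ ∩ connEvent ends a₂ o) =
      ∑ i ∈ Finset.range k, ν i * prob (w i) ((connEvent ends a₁ a₂)ᶜ ∩ connEvent ends a₂ o))
    (hD : prob p ((connEvent ends a₁ a₂)ᶜ ∩ connEvent ends a₁ a₃) =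
      ∑ i ∈ Finset.range k, ν i * prob (w i) (connEvent ends a₁ a₂)ᶜ)
    (hβ : ∀ i j, i < k → j < k → i ≤ j →
      prob (w i) ((connEvent ends a₁ a₂)ᶜ ∩ clusterInEvent ends a₁ 𝓔) *
          prob (w j) (connEvent ends a₁ a₂)ᶜ ≤
        prob (w j) ((connEvent ends a₁ a₂)ᶜ ∩ clusterInEvent ends a₁ 𝓔) *
          prob (w i) (connEvent ends a₁ a₂)ᶜ)
    (hγ : ∀ i j, i < k → j < k → i ≤ j →
      prob (w j) ((connEvent ends a₁ a₂)ᶜ ∩ connEvent ends a₂ o) *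
          prob (w i) (connEvent ends a₁ a₂)ᶜ ≤
        prob (w i) ((connEvent ends a₁ a₂)ᶜ ∩ connEvent ends a₂ o) *
          prob (w j) (connEvent ends a₁ a₂)ᶜ) :
    let Q := (connEvent ends a₁ a₂)ᶜ
    let U := clusterInEvent ends a₁ 𝓔
    let e := connEvent ends a₁ a₃
    let f := connEvent ends a₂ o
    let N := (connEvent ends a₁ a₃)ᶜ ∩ (connEvent ends a₂ a₃)ᶜ
    let oU := connEvent ends a₁ o ∪ connEvent ends a₂ o
    prob p (Q ∩ N) * (prob p Q * prob p (Q ∩ U ∩ e ∩ f) - prob p (Q ∩ U) * prob p (Q ∩ e ∩ f)) ≤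
      prob p (Q ∩ N ∩ oU) * (prob p Q * prob p (Q ∩ U ∩ e) - prob p (Q ∩ U) * prob p (Q ∩ e)) :=
  CDRequired.cd_of_required_anticorr p hp ends a₁ a₂ a₃ o h𝓔
    (ac_of_worlds p k w hw ends a₁ a₂ a₃ o h𝓔 ν hν hA hB hC hD hβ hγ)

end Main

end CDNestedMixture

end Summit.Ventures.PercRepro2
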